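import Summits.BirchSwinnertonDyer.BirchSwinnertonDyer.Theorems.PrintCf2SplitBadTwoKummerOutsideEigen
import Summits.BirchSwinnertonDyer.BirchSwinnertonDyer.Theorems.PrintCf2SplitBadTwoKummerOutsideLevelLift
import HarnessLib

/-!
# Crux `PrintCf2.SplitBadTwoRankOneOfFacts` (stmt-BirchSwinnertonDyer-20368), road α v10.3, S3c input (F3) — the image at the relaxed place
# equals the POINT INDEX: `#loc_v(𝔖_{v̄}(K, W*)) = [E(K_v) : E(K) + p^k E(K_v)]` (plain road, one statement)

Cell `bsd-print-cf2`, EXTRA WIDTH seat `bsd-line-cf2-p1-w8` g3 (prover-bsd-line-cf2-p1-w8-g3-0); `--supports stmt-BirchSwinnertonDyer-20368`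
(helper, Theses-free). HONEST FRAMING: nothing here closes the crux or a registered stub; BSD is not proved by any of this; no summit
statement is proved by this seat. No definition, no named fact, no `sorry`, no kit. beyond-print theorem: no.

WHAT. The composition of this seat's three files — p677570 (`SelmerLocImageDeep`: rank-one input at finite level + X11b's exact relaxation
index), p678401 (`KummerOutsideEigen`: e′-singular vanishing, `[KO_v : Sel]` counts the e-component), p679115 (`KummerOutsideLevelLift`: the
e-component of the singular image of `KO_v` IS `loc_v(𝔖_{v̄}(K, W*))`, via -w5 g3's level lift p677230) — into ONE statement:
**`natCard_range_resOfLe_restrictedSelmerBase_eq_index`**: for `K` totally complex, `V/K` elliptic, `p` prime with the places above `p` exactly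
`v ≠ v̄`, a CM splitting (`e` with `e ∘ ι = id` on `W* = V.endEigenPrimaryTorsion p π r`, a level-`p^k` isotropic splitting `eN + eN′ = 1` with
`ι_k ∘ eN = e ∘ ι_k`, for a Weil datum), `p^k · 𝔖_{v̄}(K, W*) = 0`, `p^j` (`j ≤ k`) killing `Ш(E/K) ∩ H¹(K,E)[p^k]`, the Mordell–Weil line
DENSE at `v` (scale `k − j`) and at `v̄` (scale `c`), the PINNING at `v` (`hα` at level `k`: e-components of local Kummer classes are classes of
rational torsion points; `hpin` at level `k + c`: the lifted Kummer classes of the multiples of `P₀` die on `D_v`):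
  **`#range(res_{D_v} ∘ 𝔖_{v̄}(K, W*).subtype) = [E(K_v) : im E(K) + p^k E(K_v)]`**,
CONDITIONAL only on the named fact `poitouTate_selmerStructure_duality K` (discharged in the tree for number fields: `…_holds`).
This is hF3 of LEAD cut 14 / `hcounts` of -w5 g3 p678471 up to (i) -w5's identification `relIndex = #range` (p677230) and (ii) the evaluation of
the point index on an S3c frame (`2^{dep(P)} · [W*′(K_v) : W*′(K)] = 2^ℓ`, i.e. `e₃ ≡ 0`; -w2 g11 / -w6 g3 point-level files).
presearch: Milne ADT I §6 Prop. 6.9 / Thm. 4.10, Greenberg LNM 1716 §5 — tree theorems; no new fact.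

References: [MilneADT2006] I Thm. 4.10(b), §6 Prop. 6.9, Lemma 6.15; [GreenbergLNM1716] §5; [JetchevSkinnerWan2017] Prop. 3.2.1, §3.3.
-/

noncomputable section

open scoped Classical

set_option linter.dupNamespace false
set_option autoImplicit false

open CategoryTheory Function Field NumberField IsDedekindDomain WeierstrassCurve
open Literature.NumberTheory.EllipticCurves Literature.NumberTheory.EllipticCurves.GreenbergSelmer
open Literature.NumberTheory.EllipticCurves.Agboola2007
open Literature.NumberTheory.GaloisRepresentations
open Literature.NumberTheory.GaloisCohomology
open scoped ContRepresentation
open Summit.BirchSwinnertonDyer.Rank1Residual.X11b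
open Summit.BirchSwinnertonDyer.Rank1Residual.X11b.LocBridge
open Summit.BirchSwinnertonDyer.Rank1Residual.X11b.Levels
open Summit.BirchSwinnertonDyer.BirchSwinnertonDyer.Theorems.PrintCf2

namespace Summit.BirchSwinnertonDyer.BirchSwinnertonDyer.Theorems.PrintCf2.SelmerLocImage

-- `NeZero (p ^ k)`, as in X11b `KummerPT`.
attribute [local instance] Levels.neZero_pow

variable {K : Type} [Field K] [NumberField K] [IsTotallyComplex K] (V : WeierstrassCurve K) [V.IsElliptic] (p : ℕ) [hp : Fact p.Prime]
  (π : V.endRing) (r : ℤ_[p]) (k : ℕ)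
  (e : V.geomPrimaryTorsion p →+ ↥(V.endEigenPrimaryTorsion p π r))
  (he : ∀ (σ : absoluteGaloisGroup K) (x : V.geomPrimaryTorsion p), e (σ • x) = σ • e x)
  (he₁ : ∀ x : ↥(V.endEigenPrimaryTorsion p π r), e x = x)
  (ε : V.geomTorsion ((p ^ k : ℕ) : ℤ) → V.geomTorsion ((p ^ k : ℕ) : ℤ) → AlgebraicClosure K)
  (hμ : ∀ S T, ε S T ^ (p ^ k) = 1)
  (hadd₁ : ∀ S₁ S₂ T, ε (S₁ + S₂) T = ε S₁ T * ε S₂ T)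
  (hadd₂ : ∀ S T₁ T₂, ε S (T₁ + T₂) = ε S T₁ * ε S T₂)
  (hgal : ∀ (σ : absoluteGaloisGroup K) (S T : V.geomTorsion ((p ^ k : ℕ) : ℤ)), σ • ε S T = ε (σ • S) (σ • T))
  (halt : ∀ T, ε T T = 1) (hnondeg : ∀ T, (∀ S, ε S T = 1) → T = 0)
  (eN eN' : (V.torsionGaloisModule ((p ^ k : ℕ) : ℤ)).toContRepresentation →ⁱL (V.torsionGaloisModule ((p ^ k : ℕ) : ℤ)).toContRepresentation)
  (heN : ∀ y, primaryInclusion V p k (eN y) = (e (primaryInclusion V p k y) : V.geomPrimaryTorsion p))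
  (hsum : ∀ x, eN x + eN' x = x)
  (hiso : ∀ x y, weilPairingHom V (p ^ k) ε hμ hadd₁ hadd₂ (eN x) (eN y) = 0)
  (hiso' : ∀ x y, weilPairingHom V (p ^ k) ε hμ hadd₁ hadd₂ (eN' x) (eN' y) = 0)

include he he₁ hgal halt hnondeg heN hsum hiso hiso' in
/-- **THE IMAGE AT THE RELAXED PLACE IS THE POINT INDEX: `#loc_v(𝔖_{v̄}(K, W*)) = [E(K_v) : im E(K) + p^k E(K_v)]`** (plain road to hF3:
p679115 `natCard_map_kummerOutside_eq_natCard_range_resOfLe` ∘ p678401 `natCard_map_kummerOutside_eq_index_of_dense` ∘ p677570), CONDITIONAL on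
`poitouTate_selmerStructure_duality K`. Hypotheses: see the module docstring (CM splitting at level `p^k`, `p^k · 𝔖_{v̄} = 0`, `p^j` kills
`Ш ∩ H¹[p^k]`, density of the Mordell–Weil line at `v` (scale `k − j`) and `v̄` (scale `c`), pinning at `v` at levels `k` (`hα`) and `k + c` (`hpin`)).
[cite: MilneADT2006, Ch. I, Thm. 4.10(b), Lemma 6.15 and §6 Prop. 6.9] [cite: GreenbergLNM1716, §5 proof of Prop. 5.8]
[cite: JetchevSkinnerWan2017, Prop. 3.2.1 and §3.3] -/
theorem natCard_range_resOfLe_restrictedSelmerBase_eq_index (hk : 0 < k) (hPT : poitouTate_selmerStructure_duality K)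
    {v vbar : HeightOneSpectrum (𝓞 K)} (hv : ((p : ℕ) : 𝓞 K) ∈ v.asIdeal) (hne : vbar ≠ v)
    (hall : ∀ w : HeightOneSpectrum (𝓞 K), ((p : ℕ) : 𝓞 K) ∈ w.asIdeal → w = v ∨ w = vbar)
    (hN : ∀ y ∈ restrictedSelmerBase ↥(V.endEigenPrimaryTorsion p π r) p vbar, p ^ k • y = 0)
    (hα : ∀ c ∈ V.kummerSelmerStructure ((p ^ k : ℕ) : ℤ) (Sum.inr v), ∃ P : V.toAffine.Point, IsOfFinAddOrder P ∧
      galoisCohomology.map (eN.restrictField (Place.Completion (Sum.inr v : Place K))) 1 c =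
        galoisCohomology.localization (V.torsionGaloisModule ((p ^ k : ℕ) : ℤ)) (Sum.inr v) 1
          (kummerMapTorsion V ((p ^ k : ℕ) : ℤ) (V.zsmul_geomPoints_surjective_holds (NeZero.ne _)) P))
    {j : ℕ} (hjk : j ≤ k)
    (hSha : V.sha ⊓ AddSubgroup.torsionBy V.galH1 ((p ^ k : ℕ) : ℤ) ≤ AddSubgroup.torsionBy V.galH1 ((p ^ j : ℕ) : ℤ))
    (hdense : (zsmulAddGroupHom ((p ^ (k - j) : ℕ) : ℤ) : (V.baseChange (v.adicCompletion K)).toAffine.Point →+ _).range ≤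
      (Affine.Point.baseChange (W' := V) K (v.adicCompletion K)).range ⊔
        (zsmulAddGroupHom ((p ^ k : ℕ) : ℤ) : (V.baseChange (v.adicCompletion K)).toAffine.Point →+ _).range)
    {c : ℕ} {P₀ : V.toAffine.Point}
    (hdense' : ∀ R : (V.baseChange (vbar.adicCompletion K)).toAffine.Point,
      ∃ (M : ℤ) (R' : (V.baseChange (vbar.adicCompletion K)).toAffine.Point),
        p ^ c • R = M • Affine.Point.baseChange (W' := V) K (vbar.adicCompletion K) P₀ + p ^ (k + c) • R')
    (hpin : ∀ M : ℤ, resOfLe ↥(V.endEigenPrimaryTorsion p π r) (inf_le_left : (⊤ : Subgroup (absoluteGaloisGroup K)) ⊓ decomp v ≤ ⊤)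
      (resH1Hom (Literature.NumberTheory.EllipticCurves.subgroupIncl (⊤ : Subgroup (absoluteGaloisGroup K)))
        (AddMonoidHom.id ↥(V.endEigenPrimaryTorsion p π r)) (fun _ _ ↦ rfl)
        (resH1Hom (ContinuousMonoidHom.id (absoluteGaloisGroup K)) e (fun σ m ↦ he σ m)
          (toDiscreteH1 (isOpen_stabilizer_geomPrimaryTorsion V p) (galoisCohomology.map (primaryInclusion V p (k + c)) 1
            (kummerMapTorsion V ((p ^ (k + c) : ℕ) : ℤ) (V.zsmul_geomPoints_surjective_holds (NeZero.ne _)) (M • P₀)))))) = 0) :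
    Nat.card ((resOfLe ↥(V.endEigenPrimaryTorsion p π r) (inf_le_left : (⊤ : Subgroup (absoluteGaloisGroup K)) ⊓ decomp v ≤ ⊤)).comp
        (restrictedSelmerBase ↥(V.endEigenPrimaryTorsion p π r) p vbar).subtype).range =
      ((Affine.Point.baseChange (W' := V) K (v.adicCompletion K)).range ⊔
        (zsmulAddGroupHom ((p ^ k : ℕ) : ℤ) : (V.baseChange (v.adicCompletion K)).toAffine.Point →+ _).range).index := by
  rw [← natCard_map_kummerOutside_eq_natCard_range_resOfLe V p π r k e he he₁ eN heN hv hne hall hN hdense' hpin]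
  exact natCard_map_kummerOutside_eq_index_of_dense V p k ε hμ hadd₁ hadd₂ hgal halt hnondeg v eN eN' hsum hiso hiso'
    (fun w ↦ IsTotallyComplex.isComplex w) hk hPT hα hjk hSha hdense

end Summit.BirchSwinnertonDyer.BirchSwinnertonDyer.Theorems.PrintCf2.SelmerLocImage

end
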